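import Literature.Analysis.FluidPDE.PartialRegularityHolds
import Literature.Analysis.FluidPDE.NSBoundedInteriorRegularityProofs
import HarnessLib

/-!
# Seregin–Šverák 2002, final step: no `L²`-concentration below a weakly vanishing final time

Analysis/FluidPDE proof file (theorems only; no definitions, no named facts). This is the
"CKN at the final time" step of the blow-up argument in Seregin–Šverák, *Navier–Stokes equations
with lower bounds on the pressure*, ARMA 163 (2002), §4, in the following self-contained form.
Let `w : ℝ → ℝ³ → ℝ³`, `q : ℝ → ℝ³ → ℝ` be such that the pair **extended by zero to positive
times** is a suitable weak solution (Caffarelli–Kohn–Nirenberg) in the box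
`(−b², b²) × B(0, b)` (this is what `ZeroExtension.isSuitableWeakSolutionOn` produces from a
blow-up limit whose final-time weak limit vanishes), and suppose the Morrey-type bound
`∫_{(s₁,s₂)×B(y,ρ)} |w|² ≤ (s₂ − s₁) M ρ` on sub-cylinders below `t = 0` (inherited from the
Type I bound). Then `w` does **not concentrate** at the final time on `B(0, a)`, `a + 2 ≤ b`:

* `SereginSverak2002.noConcentration` — for every `η > 0` there is `ε₀ > 0` with
  `∫_{(−ε,−ε/2)×B(0,a)} |w|² ≤ (ε/2)(M η + η² |B(0,a)|)` for all `0 < ε ≤ ε₀`.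

Mechanism: by the Caffarelli–Kohn–Nirenberg theorem (`ckn_partial_regularity_holds`) the
singular set of the extension in the box is `𝒫¹`-null, so the singular points `(0, y)` are
covered by centred parabolic cylinders `Q*_{rᵢ}(zᵢ)` with `∑ rᵢ < η`
(`exists_cover_of_isParabolicNull`), on which the Morrey bound gives `∫ |w|² ≤ (ε/2) M rᵢ`; at a
regular point `(0, y)` the extension is essentially bounded near `(0, y)`, hence has a continuous
representative there (`NSBoundedInteriorContinuity_holds`, Seregin–Šverák 2009 / Seregin 2014,
Prop. 3.9), which vanishes for `t > 0` and therefore is `< η` in a neighbourhood of `(0, y)`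
(`ae_norm_lt_near_regular_top_point`); compactness of `B̄(0, a)` concludes.

## References

* G. Seregin, V. Šverák, Arch. Ration. Mech. Anal. 163 (2002), 65–86, §4. [SereginSverak2002]
* L. Caffarelli, R. Kohn, L. Nirenberg, Comm. Pure Appl. Math. 35 (1982), Theorem B. [CaffarelliKohnNirenberg1982]
* G. Seregin, *Lecture notes on regularity theory for the Navier–Stokes equations*, World
  Scientific 2014, Prop. 3.9. [Seregin2014]
-/

noncomputable section

open MeasureTheory TopologicalSpace Set Function Filter Topology Metric InnerProductSpace
open scoped ENNReal NNReal RealInnerProductSpace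

namespace Literature.Analysis.FluidPDE

namespace SereginSverak2002

/-! ### Covers of parabolic null sets -/

/-- A `𝒫¹`-null set is covered by centred parabolic cylinders of radii `< 1` with `∑ rᵢ ≤ η`.
[cite: CaffarelliKohnNirenberg1982, (2.6)] -/
theorem exists_cover_of_isParabolicNull {E : Type*} [PseudoMetricSpace E] {S : Set (ℝ × E)}
    (hS : IsParabolicNull 1 S) {η : ℝ} (hη : 0 < η) :
    ∃ (z : ℕ → ℝ × E) (r : ℕ → ℝ), (∀ i, 0 ≤ r i ∧ r i < 1) ∧
      S ⊆ ⋃ i, parabolicCylinderCentered (r i) (z i) ∧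
      ∑' i, ENNReal.ofReal (r i) < ENNReal.ofReal η := by
  have h1 : parabolicHausdorffContent 1 1 S = 0 := by
    have h := hS
    rw [IsParabolicNull, parabolicHausdorff] at h
    exact le_antisymm ((le_iSup₂ (f := fun (δ : ℝ) (_ : 0 < δ) => parabolicHausdorffContent 1 δ S)
      (1 : ℝ) one_pos).trans h.le) bot_le
  have h2 : parabolicHausdorffContent 1 1 S < ENNReal.ofReal η := by
    rw [h1]; exact ENNReal.ofReal_pos.2 hη
  rw [parabolicHausdorffContent, iInf_lt_iff] at h2
  obtain ⟨z, hz⟩ := h2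
  rw [iInf_lt_iff] at hz
  obtain ⟨r, hr⟩ := hz
  rw [iInf_lt_iff] at hr
  obtain ⟨hr1, hr'⟩ := hr
  rw [iInf_lt_iff] at hr'
  obtain ⟨hcov, hsum⟩ := hr'
  refine ⟨z, r, hr1, hcov, ?_⟩
  simpa only [Real.rpow_one] using hsum

/-- Finite sub-additivity of set lower integrals over a `Finset`-indexed union. [folklore] -/
theorem lintegral_biUnion_finset_le {α ι : Type*} [MeasurableSpace α] {μ : Measure α}
    [DecidableEq ι] (t : Finset ι) (s : ι → Set α) (f : α → ℝ≥0∞) :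
    ∫⁻ x in ⋃ i ∈ t, s i, f x ∂μ ≤ ∑ i ∈ t, ∫⁻ x in s i, f x ∂μ := by
  induction t using Finset.induction_on with
  | empty => simp
  | insert i t hi ih =>
      rw [Finset.set_biUnion_insert, Finset.sum_insert hi]
      exact (lintegral_union_le _ _ _).trans (add_le_add le_rfl ih)

/-! ### Smallness near regular points of the final time -/

section Regular

variable {b : ℝ} {w : ℝ → EuclideanSpace ℝ (Fin 3) → EuclideanSpace ℝ (Fin 3)}
  {q : ℝ → EuclideanSpace ℝ (Fin 3) → ℝ}

/-- The box `(−b², b²) × B(0, b)` is open. [folklore] -/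
theorem isOpen_box (b : ℝ) :
    IsOpen (Ioo (-b ^ 2) (b ^ 2) ×ˢ ball (0 : EuclideanSpace ℝ (Fin 3)) b) :=
  isOpen_Ioo.prod isOpen_ball

/-- A centred cylinder around a point `(0, y)` of the box, inside the box. [folklore] -/
theorem parabolicCylinderCentered_subset_box (hb : 0 < b) {y : EuclideanSpace ℝ (Fin 3)}
    (hy : ‖y‖ < b) {r : ℝ} (hr : 0 ≤ r) (hr2 : r ≤ (b - ‖y‖) / 2) :
    parabolicCylinderCentered r ((0 : ℝ), y) ⊆
      Ioo (-b ^ 2) (b ^ 2) ×ˢ ball (0 : EuclideanSpace ℝ (Fin 3)) b := by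
  intro z hz
  rw [mem_parabolicCylinderCentered] at hz
  obtain ⟨⟨h1, h2⟩, h3⟩ := hz
  simp only [zero_sub, zero_add] at h1 h2
  have hrb : r < b := by linarith [norm_nonneg y]
  have hr2b : r ^ 2 < b ^ 2 := by nlinarith
  refine ⟨⟨by linarith, by linarith⟩, ?_⟩
  rw [mem_ball_zero_iff]
  calc ‖z.2‖ ≤ ‖z.2 - y‖ + ‖y‖ := norm_le_norm_sub_add _ _
    _ < r + ‖y‖ := by rw [← dist_eq_norm]; linarith
    _ < b := by linarith

/-- **Smallness of the extension near a regular point of the final time.** If the pair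
`(w̃, q̃)` extended by zero past `t = 0` is a suitable weak solution in the box and `(0, y)` is a
regular point of `w̃`, then for every `η > 0`, `‖w̃‖ < η` a.e. on some
`(−τ, 0) × B(y, σ)`. [cite: SereginSverak2002, §4; Seregin2014, Prop. 3.9] -/
theorem ae_norm_lt_near_regular_top_point (hb : 0 < b)
    (hsw : IsSuitableWeakSolutionOn ⟨Ioo (-b ^ 2) (b ^ 2) ×ˢ ball (0 : EuclideanSpace ℝ (Fin 3)) b,
      isOpen_box b⟩ 1 0 (fun t x => if t < 0 then w t x else 0) (fun t x => if t < 0 then q t x else 0))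
    {y : EuclideanSpace ℝ (Fin 3)} (hy : ‖y‖ < b)
    (hreg : IsRegularPoint (fun t x => if t < 0 then w t x else 0) ((0 : ℝ), y))
    {η : ℝ} (hη : 0 < η) :
    ∃ τ > 0, ∃ σ > 0, ∀ᵐ z ∂(volume.restrict (Ioo (-τ) 0 ×ˢ ball y σ)), ‖w z.1 z.2‖ < η := by
  set W : ℝ → EuclideanSpace ℝ (Fin 3) → EuclideanSpace ℝ (Fin 3) :=
    fun t x => if t < 0 then w t x else 0 with hW
  set Pq : ℝ → EuclideanSpace ℝ (Fin 3) → ℝ := fun t x => if t < 0 then q t x else 0 with hPq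
  -- a centred cylinder `Q*_r(0, y)` inside the box on which `W` is essentially bounded
  obtain ⟨r₀, hr₀, hbd₀⟩ := hreg
  set r : ℝ := min r₀ ((b - ‖y‖) / 2) with hr
  have hrpos : 0 < r := lt_min hr₀ (by linarith)
  have hrr₀ : r ≤ r₀ := min_le_left _ _
  have hQbox : parabolicCylinderCentered r ((0 : ℝ), y) ⊆
      Ioo (-b ^ 2) (b ^ 2) ×ˢ ball (0 : EuclideanSpace ℝ (Fin 3)) b :=
    parabolicCylinderCentered_subset_box hb hy hrpos.le (min_le_right _ _)
  have hQQ₀ : parabolicCylinderCentered r ((0 : ℝ), y) ⊆ parabolicCylinderCentered r₀ ((0 : ℝ), y) :=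
    parabolicCylinderCentered_mono hrpos.le hrr₀ _
  have hbd : eLpNorm (uncurry W) ∞ (volume.restrict (parabolicCylinderCentered r ((0 : ℝ), y))) < ∞ :=
    (eLpNorm_mono_measure _ (Measure.restrict_mono hQQ₀ le_rfl)).trans_lt hbd₀
  -- the backward cylinder `C = Q_{r/2}(r²/16, y) ⊆ Q*_r(0, y)` around `(0, y)`
  set c : ℝ × EuclideanSpace ℝ (Fin 3) := ((r ^ 2 / 16 : ℝ), y) with hc
  have hCQ : parabolicCylinder (r / 2) c ⊆ parabolicCylinderCentered r ((0 : ℝ), y) := by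
    intro z hz
    rw [mem_parabolicCylinder] at hz
    rw [mem_parabolicCylinderCentered]
    obtain ⟨⟨h1, h2⟩, h3⟩ := hz
    simp only [hc] at h1 h2 h3
    refine ⟨⟨?_, ?_⟩, ?_⟩
    · simp only [zero_sub]; nlinarith
    · simp only [zero_add]; nlinarith
    · exact h3.trans (by linarith)
  have hKQ : Icc (r ^ 2 / 16 - (r / 2) ^ 2) (r ^ 2 / 16) ×ˢ closedBall y (r / 2) ⊆
      parabolicCylinderCentered r ((0 : ℝ), y) := by
    intro z hz
    rw [mem_parabolicCylinderCentered]
    obtain ⟨⟨h1, h2⟩, h3⟩ := hz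
    rw [mem_closedBall] at h3
    refine ⟨⟨?_, ?_⟩, ?_⟩
    · simp only [zero_sub]; nlinarith
    · simp only [zero_add]; nlinarith
    · linarith
  have hCK : parabolicCylinder (r / 2) c ⊆ Icc (r ^ 2 / 16 - (r / 2) ^ 2) (r ^ 2 / 16) ×ˢ closedBall y (r / 2) := by
    intro z hz
    rw [mem_parabolicCylinder] at hz
    obtain ⟨⟨h1, h2⟩, h3⟩ := hz
    simp only [hc] at h1 h2 h3
    exact ⟨⟨h1.le, h2.le⟩, mem_closedBall.2 h3.le⟩
  -- the hypotheses of the interior continuity theorem on `C`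
  have hle : parabolicCylinderOpens (r / 2) c ≤
      (⟨Ioo (-b ^ 2) (b ^ 2) ×ˢ ball (0 : EuclideanSpace ℝ (Fin 3)) b, isOpen_box b⟩ : Opens _) := by
    intro z hz
    have hz' : z ∈ parabolicCylinder (r / 2) c := by
      have : z ∈ ((parabolicCylinderOpens (r / 2) c : Opens _) : Set (ℝ × EuclideanSpace ℝ (Fin 3))) := hz
      rwa [coe_parabolicCylinderOpens] at this
    exact hQbox (hCQ hz')
  have hdist : IsDistributionalNSSolutionOn (parabolicCylinderOpens (r / 2) c) 1 0 W Pq :=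
    hsw.distributional.of_le hle
  set M : ℝ := (eLpNorm (uncurry W) ∞ (volume.restrict (parabolicCylinderCentered r ((0 : ℝ), y)))).toReal
    with hM
  have hbdd : ∀ᵐ z ∂(volume.restrict (parabolicCylinder (r / 2) c)), ‖W z.1 z.2‖ ≤ M := by
    refine ae_restrict_of_ae_restrict_of_subset hCQ ?_
    filter_upwards [ae_le_eLpNormEssSup (μ := volume.restrict (parabolicCylinderCentered r ((0 : ℝ), y)))
      (f := uncurry W)] with z hz
    rw [← eLpNorm_exponent_top] at hz
    have := ENNReal.toReal_mono hbd.ne hz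
    rwa [toReal_enorm] at this
  have hpress : ∫⁻ z in parabolicCylinder (r / 2) c, ‖Pq z.1 z.2‖ₑ ^ (3 / 2 : ℝ) < ∞ := by
    refine lt_of_le_of_lt (lintegral_mono_set hCK) (hsw.pressure _ (hKQ.trans hQbox) ?_)
    exact (isCompact_Icc.prod (isCompact_closedBall _ _))
  obtain ⟨v, hvc, hae⟩ := NSBoundedInteriorContinuity_holds W Pq c (r / 2) M hdist hbdd hpress
  -- `v = 0` on the part of `C` above the final time
  set O : Set (ℝ × EuclideanSpace ℝ (Fin 3)) := parabolicCylinder (r / 2) c ∩ {z | 0 < z.1} with hO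
  have hOopen : IsOpen O := (isOpen_parabolicCylinder _ _).inter (isOpen_lt continuous_const continuous_fst)
  have hvO : EqOn v 0 O := by
    have h1 : uncurry W =ᵐ[volume.restrict O] v := ae_restrict_of_ae_restrict_of_subset inter_subset_left hae
    have h2 : ∀ᵐ z ∂(volume.restrict O), uncurry W z = 0 := by
      filter_upwards [ae_restrict_mem (hOopen.measurableSet)] with z hz
      have : ¬ z.1 < 0 := not_lt.2 (le_of_lt hz.2)
      simp [hW, uncurry, this]
    have h3 : v =ᵐ[volume.restrict O] (0 : ℝ × EuclideanSpace ℝ (Fin 3) → EuclideanSpace ℝ (Fin 3)) := by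
      filter_upwards [h1, h2] with z hz1 hz2
      rw [← hz1, hz2]; rfl
    exact Measure.eqOn_open_of_ae_eq h3 hOopen (hvc.mono inter_subset_left) continuousOn_const
  -- continuity of `v` at `(0, y)` within `C`
  have h0C : ((0 : ℝ), y) ∈ parabolicCylinder (r / 2) c := by
    rw [mem_parabolicCylinder]
    simp only [hc, dist_self]
    refine ⟨⟨by nlinarith, by positivity⟩, by positivity⟩
  obtain ⟨ρ, hρ, hρv⟩ := (Metric.continuousWithinAt_iff.1 (hvc _ h0C)) (η / 2) (half_pos hη)
  -- a point of `O` close to `(0, y)` shows `‖v(0, y)‖ < η/2`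
  have hv0 : ‖v ((0 : ℝ), y)‖ < η / 2 := by
    set s : ℝ := min (ρ / 2) (r ^ 2 / 32) with hs
    have hs0 : 0 < s := lt_min (half_pos hρ) (by positivity)
    have hpC : ((s : ℝ), y) ∈ parabolicCylinder (r / 2) c := by
      rw [mem_parabolicCylinder]
      simp only [hc, dist_self]
      refine ⟨⟨by nlinarith [min_le_right (ρ / 2) (r ^ 2 / 32)], ?_⟩, by positivity⟩
      linarith [min_le_right (ρ / 2) (r ^ 2 / 32)]
    have hpO : ((s : ℝ), y) ∈ O := ⟨hpC, hs0⟩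
    have hdist' : dist ((s : ℝ), y) ((0 : ℝ), y) < ρ := by
      rw [Prod.dist_eq, dist_self, Real.dist_eq, sub_zero, abs_of_pos hs0, max_eq_left hs0.le]
      linarith [min_le_left (ρ / 2) (r ^ 2 / 32)]
    have h := hρv hpC hdist'
    rw [hvO hpO, Pi.zero_apply, dist_comm, dist_zero_right] at h
    exact h
  -- the neighbourhood `(−τ, 0) × B(y, σ)`
  refine ⟨min ρ (3 * r ^ 2 / 16), lt_min hρ (by positivity), min ρ (r / 2), lt_min hρ (by positivity), ?_⟩
  have hsub : Ioo (-min ρ (3 * r ^ 2 / 16)) 0 ×ˢ ball y (min ρ (r / 2)) ⊆ parabolicCylinder (r / 2) c := by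
    intro z hz
    obtain ⟨⟨h1, h2⟩, h3⟩ := hz
    rw [mem_ball] at h3
    rw [mem_parabolicCylinder]
    simp only [hc]
    refine ⟨⟨?_, by linarith [sq_nonneg r]⟩, lt_of_lt_of_le h3 (min_le_right _ _)⟩
    nlinarith [min_le_right ρ (3 * r ^ 2 / 16)]
  have hnear : ∀ z ∈ Ioo (-min ρ (3 * r ^ 2 / 16)) 0 ×ˢ ball y (min ρ (r / 2)), ‖v z‖ < η := by
    intro z hz
    obtain ⟨⟨h1, h2⟩, h3⟩ := hz
    rw [mem_ball] at h3
    have hdz : dist z ((0 : ℝ), y) < ρ := by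
      rw [Prod.dist_eq, Real.dist_eq, sub_zero]
      refine max_lt ?_ (lt_of_lt_of_le h3 (min_le_left _ _))
      rw [abs_lt]; constructor <;> linarith [min_le_left ρ (3 * r ^ 2 / 16)]
    have h := hρv (hsub ⟨⟨h1, h2⟩, mem_ball.2 h3⟩) hdz
    calc ‖v z‖ = dist (v z) 0 := (dist_zero_right _).symm
      _ ≤ dist (v z) (v ((0 : ℝ), y)) + dist (v ((0 : ℝ), y)) 0 := dist_triangle _ _ _
      _ < η / 2 + η / 2 := add_lt_add h (by rwa [dist_zero_right])
      _ = η := by ring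
  have hae' : ∀ᵐ z ∂(volume.restrict (Ioo (-min ρ (3 * r ^ 2 / 16)) 0 ×ˢ ball y (min ρ (r / 2)))),
      uncurry W z = v z := ae_restrict_of_ae_restrict_of_subset hsub hae
  filter_upwards [hae', ae_restrict_mem (measurableSet_Ioo.prod measurableSet_ball)] with z hz hzm
  have hz0 : z.1 < 0 := hzm.1.2
  have : w z.1 z.2 = v z := by
    rw [← hz]; simp [hW, uncurry, hz0]
  rw [this]
  exact hnear z hzm

end Regular

/-! ### No concentration -/

section Main

variable {a b : ℝ} {w : ℝ → EuclideanSpace ℝ (Fin 3) → EuclideanSpace ℝ (Fin 3)}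
  {q : ℝ → EuclideanSpace ℝ (Fin 3) → ℝ}

/-- A ball of radius `< 1` meeting `B̄(0, a)` lies in `B(0, a + 2)`. [folklore] -/
theorem ball_subset_ball_of_meets {c : EuclideanSpace ℝ (Fin 3)} {r : ℝ} (hr : r < 1)
    {p : EuclideanSpace ℝ (Fin 3)} (hp : p ∈ ball c r) (hpa : p ∈ closedBall (0 : EuclideanSpace ℝ (Fin 3)) a) :
    ball c r ⊆ ball (0 : EuclideanSpace ℝ (Fin 3)) (a + 2) := by
  intro x hx
  rw [mem_ball_zero_iff]
  rw [mem_ball] at hx hp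
  rw [mem_closedBall_zero_iff] at hpa
  calc ‖x‖ = dist x 0 := (dist_zero_right _).symm
    _ ≤ dist x c + dist c p + dist p 0 := dist_triangle4 _ _ _ _
    _ < r + r + a := by
        rw [dist_comm c p, dist_zero_right]
        linarith
    _ < a + 2 := by linarith

/-- **No `L²`-concentration below a weakly vanishing final time** (see the module docstring).
[cite: SereginSverak2002, §4; CaffarelliKohnNirenberg1982, Theorem B] -/
theorem noConcentration (ha : 0 < a) (hb : a + 2 ≤ b)
    (hsw : IsSuitableWeakSolutionOn ⟨Ioo (-b ^ 2) (b ^ 2) ×ˢ ball (0 : EuclideanSpace ℝ (Fin 3)) b,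
      isOpen_box b⟩ 1 0 (fun t x => if t < 0 then w t x else 0) (fun t x => if t < 0 then q t x else 0))
    {M : ℝ} (hM : 0 ≤ M)
    (hMorrey : ∀ (y : EuclideanSpace ℝ (Fin 3)) (ρ : ℝ), 0 < ρ → ∀ s₁ s₂ : ℝ, s₁ < s₂ → s₂ < 0 →
      Ioo s₁ s₂ ×ˢ ball y ρ ⊆ parabolicCylinder b (0 : ℝ × EuclideanSpace ℝ (Fin 3)) →
      ∫ z in Ioo s₁ s₂ ×ˢ ball y ρ, ‖w z.1 z.2‖ ^ 2 ≤ (s₂ - s₁) * (M * ρ))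
    (hw2 : IntegrableOn (fun z : ℝ × EuclideanSpace ℝ (Fin 3) => ‖w z.1 z.2‖ ^ 2)
      (parabolicCylinder b (0 : ℝ × EuclideanSpace ℝ (Fin 3)))) {η : ℝ} (hη : 0 < η) :
    ∃ ε₀ > 0, ∀ ε, 0 < ε → ε ≤ ε₀ →
      ∫ z in Ioo (-ε) (-ε / 2) ×ˢ ball (0 : EuclideanSpace ℝ (Fin 3)) a, ‖w z.1 z.2‖ ^ 2 ≤
        (ε / 2) * (M * η + η ^ 2 * volume.real (ball (0 : EuclideanSpace ℝ (Fin 3)) a)) := by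
  have hb0 : 0 < b := by linarith
  set W : ℝ → EuclideanSpace ℝ (Fin 3) → EuclideanSpace ℝ (Fin 3) :=
    fun t x => if t < 0 then w t x else 0 with hW
  set Bx : Opens (ℝ × EuclideanSpace ℝ (Fin 3)) :=
    ⟨Ioo (-b ^ 2) (b ^ 2) ×ˢ ball (0 : EuclideanSpace ℝ (Fin 3)) b, isOpen_box b⟩ with hBx
  -- CKN: the singular set of the extension in the box is `𝒫¹`-null; cover it
  have hnull : IsParabolicNull 1 (singularSet W (Bx : Set (ℝ × EuclideanSpace ℝ (Fin 3)))) :=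
    ckn_partial_regularity_holds Bx one_pos hsw (isCKNForceOn_zero Bx)
  obtain ⟨zc, rc, hrc, hcov, hsum⟩ := exists_cover_of_isParabolicNull hnull hη
  -- regular points of the final time over `B̄(0, a)`: neighbourhoods where `‖w‖ < η`
  have hreg : ∀ y : {y : EuclideanSpace ℝ (Fin 3) // ‖y‖ < b ∧ IsRegularPoint W ((0 : ℝ), y)},
      ∃ τ > 0, ∃ σ > 0, ∀ᵐ z ∂(volume.restrict (Ioo (-τ) 0 ×ˢ ball y.1 σ)), ‖w z.1 z.2‖ < η :=
    fun y => ae_norm_lt_near_regular_top_point hb0 hsw y.2.1 y.2.2 hη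
  choose τ hτ σ hσ hsmall using hreg
  -- the open cover of `B̄(0, a)` and a finite subcover
  set ι := {y : EuclideanSpace ℝ (Fin 3) // ‖y‖ < b ∧ IsRegularPoint W ((0 : ℝ), y)} ⊕ ℕ
  set U : ι → Set (EuclideanSpace ℝ (Fin 3)) := fun i =>
    match i with
    | Sum.inl y => ball y.1 (σ y)
    | Sum.inr n => ball (zc n).2 (rc n) with hU
  have hUo : ∀ i, IsOpen (U i) := by
    rintro (y | n) <;> exact isOpen_ball
  have hcover : closedBall (0 : EuclideanSpace ℝ (Fin 3)) a ⊆ ⋃ i, U i := by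
    intro y hy
    rw [mem_closedBall_zero_iff] at hy
    have hyb : ‖y‖ < b := by linarith
    have hybox : ((0 : ℝ), y) ∈ (Bx : Set (ℝ × EuclideanSpace ℝ (Fin 3))) := by
      show ((0 : ℝ), y) ∈ Ioo (-b ^ 2) (b ^ 2) ×ˢ ball (0 : EuclideanSpace ℝ (Fin 3)) b
      exact ⟨⟨by nlinarith, by nlinarith⟩, mem_ball_zero_iff.2 hyb⟩
    rw [mem_iUnion]
    by_cases hregy : IsRegularPoint W ((0 : ℝ), y)
    · refine ⟨Sum.inl ⟨y, hyb, hregy⟩, ?_⟩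
      show y ∈ ball y (σ ⟨y, hyb, hregy⟩)
      exact mem_ball_self (hσ _)
    · have hyS : ((0 : ℝ), y) ∈ singularSet W (Bx : Set (ℝ × EuclideanSpace ℝ (Fin 3))) :=
        ⟨hybox, hregy⟩
      obtain ⟨n, hn⟩ := mem_iUnion.1 (hcov hyS)
      refine ⟨Sum.inr n, ?_⟩
      rw [mem_parabolicCylinderCentered] at hn
      show y ∈ ball (zc n).2 (rc n)
      exact mem_ball.2 hn.2
  obtain ⟨t, ht⟩ := (isCompact_closedBall (0 : EuclideanSpace ℝ (Fin 3)) a).elim_finite_subcover U hUo hcover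
  -- the threshold `ε₀`
  classical
  set g : ι → ℝ := fun i =>
    match i with
    | Sum.inl y => τ y
    | Sum.inr _ => b ^ 2 with hg
  have hgpos : ∀ i, 0 < g i := by
    rintro (y | n)
    · exact hτ y
    · show 0 < b ^ 2; positivity
  set ε₀ : ℝ := (insert (b ^ 2) (t.image g)).min' (Finset.insert_nonempty _ _) with hε₀
  have hε₀pos : 0 < ε₀ := by
    have hmem := (insert (b ^ 2) (t.image g)).min'_mem (Finset.insert_nonempty _ _)
    rw [← hε₀] at hmem
    rcases Finset.mem_insert.1 hmem with h | h
    · rw [h]; positivity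
    · obtain ⟨i, -, hi⟩ := Finset.mem_image.1 h
      rw [← hi]; exact hgpos i
  have hε₀b : ε₀ ≤ b ^ 2 := Finset.min'_le _ _ (Finset.mem_insert_self _ _)
  have hε₀g : ∀ i ∈ t, ε₀ ≤ g i := fun i hi =>
    Finset.min'_le _ _ (Finset.mem_insert_of_mem (Finset.mem_image_of_mem g hi))
  refine ⟨ε₀, hε₀pos, fun ε hε hεε₀ => ?_⟩
  -- notation for the window and the two parts of the cover
  set Wt : Set ℝ := Ioo (-ε) (-ε / 2) with hWt
  set R : Set (EuclideanSpace ℝ (Fin 3)) := ⋃ y ∈ t.toLeft, ball y.1 (σ y) with hR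
  set Sg : Set (EuclideanSpace ℝ (Fin 3)) :=
    ⋃ n ∈ t.toRight.filter (fun n => (ball (zc n).2 (rc n) ∩ closedBall (0 : EuclideanSpace ℝ (Fin 3)) a).Nonempty),
      ball (zc n).2 (rc n) with hSg
  have hsplit : ball (0 : EuclideanSpace ℝ (Fin 3)) a ⊆ R ∪ Sg := by
    intro x hx
    have hx' : x ∈ closedBall (0 : EuclideanSpace ℝ (Fin 3)) a := ball_subset_closedBall hx
    obtain ⟨i, hi, hxi⟩ := mem_iUnion₂.1 (ht hx')
    rcases i with y | n
    · left
      exact mem_iUnion₂.2 ⟨y, Finset.mem_toLeft.2 hi, hxi⟩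
    · right
      refine mem_iUnion₂.2 ⟨n, Finset.mem_filter.2 ⟨Finset.mem_toRight.2 hi, ⟨x, hxi, hx'⟩⟩, hxi⟩
  -- measurability and finiteness facts
  have hWm : MeasurableSet Wt := measurableSet_Ioo
  have hvolW : volume Wt = ENNReal.ofReal (ε / 2) := by
    rw [hWt, Real.volume_Ioo]; congr 1; ring
  -- (1) the regular part: `‖w‖ < η` a.e. on `Wt × R`
  have hWτ : ∀ y ∈ t.toLeft, Wt ⊆ Ioo (-τ y) 0 := by
    intro y hy
    have h1 : ε₀ ≤ τ y := hε₀g (Sum.inl y) (Finset.mem_toLeft.1 hy)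
    intro s hs
    exact ⟨by linarith [hs.1], by linarith [hs.2]⟩
  have haeR : ∀ᵐ z ∂(volume.restrict (Wt ×ˢ R)), ‖w z.1 z.2‖ < η := by
    have hRU : Wt ×ˢ R = ⋃ y ∈ t.toLeft, Wt ×ˢ ball y.1 (σ y) := by
      rw [hR, prod_iUnion₂]
    rw [hRU, ae_restrict_biUnion_finset_iff]
    intro y hy
    exact ae_restrict_of_ae_restrict_of_subset (prod_mono (hWτ y hy) subset_rfl) (hsmall y)
  have hlinR : ∫⁻ z in Wt ×ˢ (ball (0 : EuclideanSpace ℝ (Fin 3)) a ∩ R), ‖w z.1 z.2‖ₑ ^ 2 ≤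
      ENNReal.ofReal (η ^ 2) * (ENNReal.ofReal (ε / 2) * volume (ball (0 : EuclideanSpace ℝ (Fin 3)) a)) := by
    have hsub : Wt ×ˢ (ball (0 : EuclideanSpace ℝ (Fin 3)) a ∩ R) ⊆ Wt ×ˢ R :=
      prod_mono subset_rfl inter_subset_right
    have hae := ae_restrict_of_ae_restrict_of_subset hsub haeR
    calc ∫⁻ z in Wt ×ˢ (ball (0 : EuclideanSpace ℝ (Fin 3)) a ∩ R), ‖w z.1 z.2‖ₑ ^ 2
        ≤ ∫⁻ _ in Wt ×ˢ (ball (0 : EuclideanSpace ℝ (Fin 3)) a ∩ R), ENNReal.ofReal (η ^ 2) := by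
          refine lintegral_mono_ae ?_
          filter_upwards [hae] with z hz
          rw [← ofReal_norm, ← ENNReal.ofReal_pow (norm_nonneg _)]
          exact ENNReal.ofReal_le_ofReal (by nlinarith [norm_nonneg (w z.1 z.2)])
      _ = ENNReal.ofReal (η ^ 2) * volume (Wt ×ˢ (ball (0 : EuclideanSpace ℝ (Fin 3)) a ∩ R)) := by
          rw [setLIntegral_const]
      _ ≤ ENNReal.ofReal (η ^ 2) * volume (Wt ×ˢ ball (0 : EuclideanSpace ℝ (Fin 3)) a) := by
          gcongr; exact inter_subset_left
      _ = ENNReal.ofReal (η ^ 2) * (ENNReal.ofReal (ε / 2) * volume (ball (0 : EuclideanSpace ℝ (Fin 3)) a)) := by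
          rw [Measure.volume_eq_prod, Measure.prod_prod]
          congr 1
          rw [show (volume : Measure ℝ) Wt = ENNReal.ofReal (ε / 2) from hvolW]
  -- (2) the singular part: Morrey bound on each small ball
  have hlinS : ∫⁻ z in Wt ×ˢ Sg, ‖w z.1 z.2‖ₑ ^ 2 ≤ ENNReal.ofReal ((ε / 2) * (M * η)) := by
    set tN := t.toRight.filter (fun n => (ball (zc n).2 (rc n) ∩ closedBall (0 : EuclideanSpace ℝ (Fin 3)) a).Nonempty)
      with htN
    have hSU : Wt ×ˢ Sg = ⋃ n ∈ tN, Wt ×ˢ ball (zc n).2 (rc n) := by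
      rw [hSg, prod_iUnion₂]
    rw [hSU]
    refine (lintegral_biUnion_finset_le tN _ _).trans ?_
    -- each piece
    have hpiece : ∀ n ∈ tN, ∫⁻ z in Wt ×ˢ ball (zc n).2 (rc n), ‖w z.1 z.2‖ₑ ^ 2 ≤
        ENNReal.ofReal ((ε / 2) * (M * rc n)) := by
      intro n hn
      obtain ⟨-, hmeet⟩ := Finset.mem_filter.1 hn
      rcases (hrc n).1.eq_or_lt with h0 | hpos
      · -- radius zero: empty ball
        rw [← h0, ball_zero, prod_empty, Measure.restrict_empty, lintegral_zero_measure]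
        exact bot_le
      · obtain ⟨p, hp, hpa⟩ := hmeet
        have hballb : ball (zc n).2 (rc n) ⊆ ball (0 : EuclideanSpace ℝ (Fin 3)) b :=
          (ball_subset_ball_of_meets (hrc n).2 hp hpa).trans (ball_subset_ball hb)
        have hsubQ : Wt ×ˢ ball (zc n).2 (rc n) ⊆ parabolicCylinder b (0 : ℝ × EuclideanSpace ℝ (Fin 3)) := by
          intro z hz
          rw [mem_parabolicCylinder]
          obtain ⟨⟨h1, h2⟩, h3⟩ := hz
          refine ⟨⟨?_, by simp only [Prod.fst_zero]; linarith⟩, ?_⟩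
          · simp only [Prod.fst_zero]
            have : ε ≤ b ^ 2 := hεε₀.trans hε₀b
            nlinarith
          · simpa using hballb h3
        have hint : IntegrableOn (fun z : ℝ × EuclideanSpace ℝ (Fin 3) => ‖w z.1 z.2‖ ^ 2)
            (Wt ×ˢ ball (zc n).2 (rc n)) := hw2.mono_set hsubQ
        have hM' := hMorrey (zc n).2 (rc n) hpos (-ε) (-ε / 2) (by linarith) (by linarith) hsubQ
        have e : ∫⁻ z in Wt ×ˢ ball (zc n).2 (rc n), ‖w z.1 z.2‖ₑ ^ 2 =
            ENNReal.ofReal (∫ z in Wt ×ˢ ball (zc n).2 (rc n), ‖w z.1 z.2‖ ^ 2) := by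
          rw [ofReal_integral_eq_lintegral_ofReal hint (Eventually.of_forall fun z => sq_nonneg _)]
          refine lintegral_congr fun z => ?_
          rw [← ofReal_norm, ENNReal.ofReal_pow (norm_nonneg _)]
        rw [e]
        refine ENNReal.ofReal_le_ofReal (hM'.trans (le_of_eq ?_))
        ring
    refine (Finset.sum_le_sum hpiece).trans ?_
    rw [← ENNReal.ofReal_sum_of_nonneg (fun n _ => by
      have := (hrc n).1; positivity)]
    refine ENNReal.ofReal_le_ofReal ?_
    rw [← Finset.mul_sum, ← Finset.mul_sum]
    refine mul_le_mul_of_nonneg_left (mul_le_mul_of_nonneg_left ?_ hM) (by linarith)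
    -- `∑_{n ∈ tN} rc n ≤ η`
    have h1 : ∑ n ∈ tN, ENNReal.ofReal (rc n) ≤ ENNReal.ofReal η :=
      (ENNReal.sum_le_tsum tN).trans hsum.le
    rw [← ENNReal.ofReal_sum_of_nonneg (fun n _ => (hrc n).1)] at h1
    exact (ENNReal.ofReal_le_ofReal_iff hη.le).1 h1
  -- (3) assemble
  have hsubQa : Wt ×ˢ ball (0 : EuclideanSpace ℝ (Fin 3)) a ⊆
      parabolicCylinder b (0 : ℝ × EuclideanSpace ℝ (Fin 3)) := by
    intro z hz
    rw [mem_parabolicCylinder]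
    obtain ⟨⟨h1, h2⟩, h3⟩ := hz
    refine ⟨⟨?_, by simp only [Prod.fst_zero]; linarith⟩, ?_⟩
    · simp only [Prod.fst_zero]
      have : ε ≤ b ^ 2 := hεε₀.trans hε₀b
      nlinarith
    · simpa using ball_subset_ball (by linarith : a ≤ b) h3
  have hint : IntegrableOn (fun z : ℝ × EuclideanSpace ℝ (Fin 3) => ‖w z.1 z.2‖ ^ 2)
      (Wt ×ˢ ball (0 : EuclideanSpace ℝ (Fin 3)) a) := hw2.mono_set hsubQa
  have hlin : ∫⁻ z in Wt ×ˢ ball (0 : EuclideanSpace ℝ (Fin 3)) a, ‖w z.1 z.2‖ₑ ^ 2 ≤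
      ENNReal.ofReal ((ε / 2) * (M * η + η ^ 2 * volume.real (ball (0 : EuclideanSpace ℝ (Fin 3)) a))) := by
    have hsub : Wt ×ˢ ball (0 : EuclideanSpace ℝ (Fin 3)) a ⊆
        Wt ×ˢ (ball (0 : EuclideanSpace ℝ (Fin 3)) a ∩ R) ∪ Wt ×ˢ Sg := by
      rintro z ⟨hz1, hz2⟩
      rcases hsplit hz2 with h | h
      · exact Or.inl ⟨hz1, hz2, h⟩
      · exact Or.inr ⟨hz1, h⟩
    calc ∫⁻ z in Wt ×ˢ ball (0 : EuclideanSpace ℝ (Fin 3)) a, ‖w z.1 z.2‖ₑ ^ 2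
        ≤ ∫⁻ z in Wt ×ˢ (ball (0 : EuclideanSpace ℝ (Fin 3)) a ∩ R) ∪ Wt ×ˢ Sg, ‖w z.1 z.2‖ₑ ^ 2 :=
          lintegral_mono_set hsub
      _ ≤ (∫⁻ z in Wt ×ˢ (ball (0 : EuclideanSpace ℝ (Fin 3)) a ∩ R), ‖w z.1 z.2‖ₑ ^ 2) +
            ∫⁻ z in Wt ×ˢ Sg, ‖w z.1 z.2‖ₑ ^ 2 := lintegral_union_le _ _ _
      _ ≤ ENNReal.ofReal (η ^ 2) * (ENNReal.ofReal (ε / 2) * volume (ball (0 : EuclideanSpace ℝ (Fin 3)) a)) +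
            ENNReal.ofReal ((ε / 2) * (M * η)) := add_le_add hlinR hlinS
      _ = ENNReal.ofReal ((ε / 2) * (M * η + η ^ 2 * volume.real (ball (0 : EuclideanSpace ℝ (Fin 3)) a))) := by
          have hvol : volume (ball (0 : EuclideanSpace ℝ (Fin 3)) a) =
              ENNReal.ofReal (volume.real (ball (0 : EuclideanSpace ℝ (Fin 3)) a)) := by
            rw [Measure.real, ENNReal.ofReal_toReal measure_ball_lt_top.ne]
          rw [hvol, ← ENNReal.ofReal_mul (by positivity), ← ENNReal.ofReal_mul (by positivity),
            ← ENNReal.ofReal_add (by positivity) (by positivity)]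
          congr 1
          ring
  -- back to real integrals
  have e : ∫⁻ z in Wt ×ˢ ball (0 : EuclideanSpace ℝ (Fin 3)) a, ‖w z.1 z.2‖ₑ ^ 2 =
      ENNReal.ofReal (∫ z in Wt ×ˢ ball (0 : EuclideanSpace ℝ (Fin 3)) a, ‖w z.1 z.2‖ ^ 2) := by
    rw [ofReal_integral_eq_lintegral_ofReal hint (Eventually.of_forall fun z => sq_nonneg _)]
    refine lintegral_congr fun z => ?_
    rw [← ofReal_norm, ENNReal.ofReal_pow (norm_nonneg _)]
  rw [e] at hlin
  exact (ENNReal.ofReal_le_ofReal_iff (by positivity)).1 hlin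

end Main

end SereginSverak2002

end Literature.Analysis.FluidPDE

end
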